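import Mathlib
import Summits.Ventures.FusionMHD.Models.SAlphaSecondStableS3A5675PointPrep
import HarnessLib

/-!
# F3 row «F3.BALLOON-sα-SECOND-STABILITY-S3-A5675»: at `(s, α) = (3, 227/40)` — ABOVE the unstable band at shear `3` — the `s–α` ballooning MODEL is on the STABLE SIDE again (`SAlpha.StableSide (3) (227/40)`) — a THIRD point of the second-stability side at shear `3`, HALF-WAY into the bracket `[28/5, 23/4]` of `SAlphaSecondStableS3A575Point.stableSide_three_575` (model-7 g9/g10) and ★ #284; with gridfusion-lit-3's `Summit.Ventures.FusionMHD.Bench.SAlphaS3W55.unstableWitness_56` (`28/5 ∈ U_{3}`) the SECOND stability edge at `s = 3` lies in the CLOSED interval `[28/5, 227/40]` (width `3/40`)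

LADDER-GRIDFUSION rung F3 (cell `gridfusion`; DIRECTOR RULING 67 (5) + the director's class reading I4107 (2): the second stability edge is «a second
bracketed quantity per shear», booked on merits, no cap slot; ★ #284 «S3-SECOND-EDGE-BRACKET» is the `s = 3` instance).  Assembly by gridfusion-model-7 g10,
2026-08-28, in model-7 g8's multi-piece CORE LANE exactly as g9's `SAlphaSecondStableS3A6*` (generator HOME/models/model-7/g9/stable2/, design
`design36.py 3 5.675 <g9's 12 pieces on [0,18]> 8 18`): (i) 12 kernel-certified core amplitude pieces `SAlphaSecondStableS3A5675Core0…11` (polynomials `Q0…Q11` on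
`[0,1/2] ∪ [1/2,1] ∪ [1,3/2] ∪ [3/2,7/4] ∪ [7/4,2] ∪ [2,5/2] ∪ [5/2,3] ∪ [3,4] ∪ [4,6] ∪ [6,10] ∪ [10,14] ∪ [14,18]`, degrees ≤ 33, the first EVEN; Taylor-model POSITIVITY leaves of half-width `1/32` on `[0, 3]`, `1/16` beyond, deciding `F_k > 0` and
`amplitudeResidual (3) (227/40) F_k F_k″ ≤ 0` piece by piece; slacks `η_k = 0.0008 … 0.00135` increasing to the right; trig point values with 20 terms after 5 halvings),
and (ii) gridfusion-lit-4's engine `Literature/MathematicalPhysics/MHD/BallooningSAlphaStableSide.lean` (`energyDominatesOn_of_amplitude`,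
`EnergyDominatesOn.glue`, the explicit tail `(1 − c/θ)(1 + (α/s²) cos θ/θ²)` with `energyDominatesOn_tail` / `tail_logDeriv_le` at `(c, T) = (8, 18)` —
side condition `tailBound (3) (227/40) 8 18 ≥ 0` by `norm_num`; the junction `c/(T(T−c)) + (α/s²)(T+2)/(T(T²−α/s²)) = 0.04661… ≤ F′(18)/F(18) = 0.05572…`
exact —, `stableSide_of_core_tail`).  The 28-statement program `ss35675Prog` carries the shear; its top register is PROVED `= −amplitudeResidual (3) (227/40) F F″`.
All junctions and the tail junction are exact-rational inequalities; `F₀′(0) = 0` exactly.  0 kit in the kernel objects; no `native_decide`.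
Margin to the float second edge 5.614: 0.061 (min F ≈ 0.20 near θ ≈ 1.9 — the even Liouville solution dips but stays positive).

## THREE COLUMNS
CERTIFIED: in the `s–α` ballooning MODEL (Freidberg (12.96)–(12.99), `Λ = sθ − α sin θ`, `θ₀ = 0`) at `(s, α) = (3, 227/40)`: for EVERY window `[a, b]` and
every trial function `X` differentiable on `[a, b]` with `X(a) = X(b) = 0` there is NO `SAlpha.UnstableWitness` (`stableSide_three_5675`) — the surface is on the
stable side although it lies ABOVE the certified-unstable surfaces of the same shear: with gridfusion-lit-3's `Summit.Ventures.FusionMHD.Bench.SAlphaS3W55.unstableWitness_56` (`(3, 28/5)` unstable)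
the MODEL's SECOND stability boundary at `s = 3`, `sup {α ≤ 227/40 : α ∈ U_{3}}`, lies in the CLOSED interval `[28/5, 227/40]` (width `3/40`);
monotonicity / connectedness of the unstable set in `α` is NOT typed.  VALIDATED (not in the kernel): float E–L shooting puts the second edge at
`α ≈ 5.614` for `s = 3` (lit-3 `edges.py` / model-7 g9 kit j304843); Freidberg Fig. 12.5 shows the second-stable region qualitatively; float
Liouville amplitude: `F′/F(18) ≈ 0.0557`, `min F ≈ 0.201`, slack margins `E/((1+Λ²)²F) ≤ −η_k`.  MODELLED: `s–α` model (large-aspect-ratio shifted circles,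
high-`n` ballooning ordering, `θ₀ = 0`, ideal MHD); «stable side» = the MODEL's one-surface functional admits no negative compactly supported trial function
(lit-3's witness class); the representation step (Connor–Hastie–Taylor 1979) is quoted in the Literature file, not typed; in particular NOTHING is claimed
about `θ₀ ≠ 0`, about a device, or about a `β`-limit.
Citations: Freidberg 2014 §12.3, §12.6.2 (12.96)–(12.100), Fig. 12.5 [Freidberg2014]; Hartman 2002 XI.6.2 [Hartman2002]; Makino–Berz 2003 Alg. 2
[MakinoBerz2003].  Everything below is [instance data].
-/

open Literature.Analysis.ValidatedNumerics Literature.Analysis.ValidatedNumerics.PolyMP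
open Literature.Analysis.ValidatedNumerics.NumericsMP Literature.Analysis.ValidatedNumerics.ExpPoly
open Literature.MathematicalPhysics.MHD.Ballooning
open Real Set

namespace Summit.Ventures.FusionMHD.Models

namespace SAlphaSecondStableS3A5675

/-! (PART 2/2: §2 the junction inequalities + tail facts, §3 the assembly; §1 lives in `SAlphaSecondStableS3A5675PointPrep`.) -/

/-! ### §2 The junctions (log-derivative drops) -/

/-- Junction at `1/2`: `F_1′/F_1 ≤ F_0′/F_0` there (the phase drops). [instance data] -/
theorem ss35675_junction01 : (SAlpha.amplitudePhase 3 (227 / 40) (Poly.eval Q1) (Poly.eval (Poly.deriv Q1))) (1 / 2 : ℝ) ≤ (SAlpha.amplitudePhase 3 (227 / 40) (Poly.eval Q0) (Poly.eval (Poly.deriv Q0))) (1 / 2 : ℝ) := by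
  rw [SAlpha.amplitudePhase_le_iff, ← deriv_Q1, ← deriv_Q0, Q1_at_a, Q1d_at_a, Q0_at_b, Q0d_at_b]
  norm_num

/-- Junction at `1`: `F_2′/F_2 ≤ F_1′/F_1` there (the phase drops). [instance data] -/
theorem ss35675_junction12 : (SAlpha.amplitudePhase 3 (227 / 40) (Poly.eval Q2) (Poly.eval (Poly.deriv Q2))) (1 : ℝ) ≤ (SAlpha.amplitudePhase 3 (227 / 40) (Poly.eval Q1) (Poly.eval (Poly.deriv Q1))) (1 : ℝ) := by
  rw [SAlpha.amplitudePhase_le_iff, ← deriv_Q2, ← deriv_Q1, Q2_at_a, Q2d_at_a, Q1_at_b, Q1d_at_b]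
  norm_num

/-- Junction at `3/2`: `F_3′/F_3 ≤ F_2′/F_2` there (the phase drops). [instance data] -/
theorem ss35675_junction23 : (SAlpha.amplitudePhase 3 (227 / 40) (Poly.eval Q3) (Poly.eval (Poly.deriv Q3))) (3 / 2 : ℝ) ≤ (SAlpha.amplitudePhase 3 (227 / 40) (Poly.eval Q2) (Poly.eval (Poly.deriv Q2))) (3 / 2 : ℝ) := by
  rw [SAlpha.amplitudePhase_le_iff, ← deriv_Q3, ← deriv_Q2, Q3_at_a, Q3d_at_a, Q2_at_b, Q2d_at_b]
  norm_num

/-- Junction at `7/4`: `F_4′/F_4 ≤ F_3′/F_3` there (the phase drops). [instance data] -/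
theorem ss35675_junction34 : (SAlpha.amplitudePhase 3 (227 / 40) (Poly.eval Q4) (Poly.eval (Poly.deriv Q4))) (7 / 4 : ℝ) ≤ (SAlpha.amplitudePhase 3 (227 / 40) (Poly.eval Q3) (Poly.eval (Poly.deriv Q3))) (7 / 4 : ℝ) := by
  rw [SAlpha.amplitudePhase_le_iff, ← deriv_Q4, ← deriv_Q3, Q4_at_a, Q4d_at_a, Q3_at_b, Q3d_at_b]
  norm_num

/-- Junction at `2`: `F_5′/F_5 ≤ F_4′/F_4` there (the phase drops). [instance data] -/
theorem ss35675_junction45 : (SAlpha.amplitudePhase 3 (227 / 40) (Poly.eval Q5) (Poly.eval (Poly.deriv Q5))) (2 : ℝ) ≤ (SAlpha.amplitudePhase 3 (227 / 40) (Poly.eval Q4) (Poly.eval (Poly.deriv Q4))) (2 : ℝ) := by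
  rw [SAlpha.amplitudePhase_le_iff, ← deriv_Q5, ← deriv_Q4, Q5_at_a, Q5d_at_a, Q4_at_b, Q4d_at_b]
  norm_num

/-- Junction at `5/2`: `F_6′/F_6 ≤ F_5′/F_5` there (the phase drops). [instance data] -/
theorem ss35675_junction56 : (SAlpha.amplitudePhase 3 (227 / 40) (Poly.eval Q6) (Poly.eval (Poly.deriv Q6))) (5 / 2 : ℝ) ≤ (SAlpha.amplitudePhase 3 (227 / 40) (Poly.eval Q5) (Poly.eval (Poly.deriv Q5))) (5 / 2 : ℝ) := by
  rw [SAlpha.amplitudePhase_le_iff, ← deriv_Q6, ← deriv_Q5, Q6_at_a, Q6d_at_a, Q5_at_b, Q5d_at_b]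
  norm_num

/-- Junction at `3`: `F_7′/F_7 ≤ F_6′/F_6` there (the phase drops). [instance data] -/
theorem ss35675_junction67 : (SAlpha.amplitudePhase 3 (227 / 40) (Poly.eval Q7) (Poly.eval (Poly.deriv Q7))) (3 : ℝ) ≤ (SAlpha.amplitudePhase 3 (227 / 40) (Poly.eval Q6) (Poly.eval (Poly.deriv Q6))) (3 : ℝ) := by
  rw [SAlpha.amplitudePhase_le_iff, ← deriv_Q7, ← deriv_Q6, Q7_at_a, Q7d_at_a, Q6_at_b, Q6d_at_b]
  norm_num

/-- Junction at `4`: `F_8′/F_8 ≤ F_7′/F_7` there (the phase drops). [instance data] -/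
theorem ss35675_junction78 : (SAlpha.amplitudePhase 3 (227 / 40) (Poly.eval Q8) (Poly.eval (Poly.deriv Q8))) (4 : ℝ) ≤ (SAlpha.amplitudePhase 3 (227 / 40) (Poly.eval Q7) (Poly.eval (Poly.deriv Q7))) (4 : ℝ) := by
  rw [SAlpha.amplitudePhase_le_iff, ← deriv_Q8, ← deriv_Q7, Q8_at_a, Q8d_at_a, Q7_at_b, Q7d_at_b]
  norm_num

/-- Junction at `6`: `F_9′/F_9 ≤ F_8′/F_8` there (the phase drops). [instance data] -/
theorem ss35675_junction89 : (SAlpha.amplitudePhase 3 (227 / 40) (Poly.eval Q9) (Poly.eval (Poly.deriv Q9))) (6 : ℝ) ≤ (SAlpha.amplitudePhase 3 (227 / 40) (Poly.eval Q8) (Poly.eval (Poly.deriv Q8))) (6 : ℝ) := by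
  rw [SAlpha.amplitudePhase_le_iff, ← deriv_Q9, ← deriv_Q8, Q9_at_a, Q9d_at_a, Q8_at_b, Q8d_at_b]
  norm_num

/-- Junction at `10`: `F_10′/F_10 ≤ F_9′/F_9` there (the phase drops). [instance data] -/
theorem ss35675_junction910 : (SAlpha.amplitudePhase 3 (227 / 40) (Poly.eval Q10) (Poly.eval (Poly.deriv Q10))) (10 : ℝ) ≤ (SAlpha.amplitudePhase 3 (227 / 40) (Poly.eval Q9) (Poly.eval (Poly.deriv Q9))) (10 : ℝ) := by
  rw [SAlpha.amplitudePhase_le_iff, ← deriv_Q10, ← deriv_Q9, Q10_at_a, Q10d_at_a, Q9_at_b, Q9d_at_b]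
  norm_num

/-- Junction at `14`: `F_11′/F_11 ≤ F_10′/F_10` there (the phase drops). [instance data] -/
theorem ss35675_junction1011 : (SAlpha.amplitudePhase 3 (227 / 40) (Poly.eval Q11) (Poly.eval (Poly.deriv Q11))) (14 : ℝ) ≤ (SAlpha.amplitudePhase 3 (227 / 40) (Poly.eval Q10) (Poly.eval (Poly.deriv Q10))) (14 : ℝ) := by
  rw [SAlpha.amplitudePhase_le_iff, ← deriv_Q11, ← deriv_Q10, Q11_at_a, Q11d_at_a, Q10_at_b, Q10d_at_b]
  norm_num

/-- Tail junction at `18`: the tail's bound `c/(T(T − c)) + α(T + 2)/(T(T² − α)) = 81392/1746195` (`c = 8`) is below `F′(T)/F(T)` of the last piece. [instance data] -/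
theorem ss35675_junction_tail :
    (8 : ℝ) / ((18 : ℝ) * ((18 : ℝ) - (8 : ℝ))) + (227 / 40 : ℝ) / (3 : ℝ) ^ 2 * ((18 : ℝ) + 2) / ((18 : ℝ) * ((18 : ℝ) ^ 2 - (227 / 40 : ℝ) / (3 : ℝ) ^ 2))
      ≤ Poly.eval (Poly.deriv Q11) (18 : ℝ) / Poly.eval Q11 (18 : ℝ) := by
  rw [← deriv_Q11, Q11_at_b, Q11d_at_b]
  norm_num

/-- The tail side condition `tailBound 3 (227/40) 8 18 ≥ 0` of lit-4's explicit tail amplitude. [instance data] -/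
theorem ss35675_tailBound_nonneg : 0 ≤ SAlpha.tailBound 3 (227 / 40) (8 : ℝ) (18 : ℝ) := by
  norm_num [SAlpha.tailBound, SAlpha.tailMajorant, SAlpha.tailMaj7, SAlpha.tailMaj6, SAlpha.tailMaj5, SAlpha.tailMaj4,
    SAlpha.tailMaj3, SAlpha.tailMaj2, SAlpha.tailMaj1]

/-! ### §3 Assembly -/

/-- The glued core phase on `[0, 18]` dominates the energy. [instance data] -/
theorem ss35675_dominates_core :
    SAlpha.EnergyDominatesOn 3 (227 / 40) (fun θ => if θ ≤ (14 : ℝ) then (if θ ≤ (10 : ℝ) then (if θ ≤ (6 : ℝ) then (if θ ≤ (4 : ℝ) then (if θ ≤ (3 : ℝ) then (if θ ≤ (5 / 2 : ℝ) then (if θ ≤ (2 : ℝ) then (if θ ≤ (7 / 4 : ℝ) then (if θ ≤ (3 / 2 : ℝ) then (if θ ≤ (1 : ℝ) then (if θ ≤ (1 / 2 : ℝ) then ((SAlpha.amplitudePhase 3 (227 / 40) (Poly.eval Q0) (Poly.eval (Poly.deriv Q0))) θ) else (SAlpha.amplitudePhase 3 (227 / 40) (Poly.eval Q1) (Poly.eval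 (Poly.deriv Q1))) θ) else (SAlpha.amplitudePhase 3 (227 / 40) (Poly.eval Q2) (Poly.eval (Poly.deriv Q2))) θ) else (SAlpha.amplitudePhase 3 (227 / 40) (Poly.eval Q3) (Poly.eval (Poly.deriv Q3))) θ) else (SAlpha.amplitudePhase 3 (227 / 40) (Poly.eval Q4) (Poly.eval (Poly.deriv Q4))) θ) else (SAlpha.amplitudePhase 3 (227 / 40) (Poly.eval Q5) (Poly.eval (Poly.deriv Q5))) θ) else (SAlpha.amplitudePhase 3 (227 / 40) (Poly.eval Q6) (Poly.eval (Poly.deriv Q6))) θ) else (SAlpha.amplitudePhase 3 (227 / 40) (Poly.eval Q7) (Poly.eval (Poly.deriv Q7))) θ) else (SAlpha.amplitudePhase 3 (227 / 40) (Poly.eval Q8) (Poly.eval (Poly.deriv Q8))) θ) else (SAlpha.amplitudePhase 3 (227 / 40) (Poly.eval Q9) (Poly.eval (Poly.deriv Q9))) θ) else (SAlpha.amplitudePhase 3 (227 / 40) (Poly.eval Q10) (Poly.eval (Poly.deriv Q10))) θ) else (SAlpha.amplitudePhase 3 (227 / 40) (Poly.eval Q11) (Poly.eval (Poly.deriv Q11)))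 θ) (Icc 0 (18 : ℝ)) := by
  have h0 := ss35675_dominates0
  have h1 := ss35675_dominates1
  have h2 := ss35675_dominates2
  have h3 := ss35675_dominates3
  have h4 := ss35675_dominates4
  have h5 := ss35675_dominates5
  have h6 := ss35675_dominates6
  have h7 := ss35675_dominates7
  have h8 := ss35675_dominates8
  have h9 := ss35675_dominates9
  have h10 := ss35675_dominates10
  have h11 := ss35675_dominates11
  have g1 : SAlpha.EnergyDominatesOn 3 (227 / 40) (fun θ => if θ ≤ (1 / 2 : ℝ) then ((SAlpha.amplitudePhase 3 (227 / 40) (Poly.eval Q0) (Poly.eval (Poly.deriv Q0))) θ) else (SAlpha.amplitudePhase 3 (227 / 40) (Poly.eval Q1) (Poly.eval (Poly.deriv Q1))) θ) (Icc 0 (1 : ℝ)) := by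
    refine SAlpha.EnergyDominatesOn.glue (h0.mono ?_) (h1.mono ?_) ?_
    · intro θ hθ; exact ⟨hθ.1.1, hθ.2⟩
    · intro θ hθ; exact ⟨hθ.2, hθ.1.2⟩
    · exact ss35675_junction01
  have g2 : SAlpha.EnergyDominatesOn 3 (227 / 40) (fun θ => if θ ≤ (1 : ℝ) then (if θ ≤ (1 / 2 : ℝ) then ((SAlpha.amplitudePhase 3 (227 / 40) (Poly.eval Q0) (Poly.eval (Poly.deriv Q0))) θ) else (SAlpha.amplitudePhase 3 (227 / 40) (Poly.eval Q1) (Poly.eval (Poly.deriv Q1))) θ) else (SAlpha.amplitudePhase 3 (227 / 40) (Poly.eval Q2) (Poly.eval (Poly.deriv Q2))) θ) (Icc 0 (3 / 2 : ℝ)) := by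
    refine SAlpha.EnergyDominatesOn.glue (g1.mono ?_) (h2.mono ?_) ?_
    · intro θ hθ; exact ⟨hθ.1.1, hθ.2⟩
    · intro θ hθ; exact ⟨hθ.2, hθ.1.2⟩
    · simp only [show ¬ ((1 : ℝ) ≤ (1 / 2 : ℝ)) from by norm_num, if_false]
      exact ss35675_junction12
  have g3 : SAlpha.EnergyDominatesOn 3 (227 / 40) (fun θ => if θ ≤ (3 / 2 : ℝ) then (if θ ≤ (1 : ℝ) then (if θ ≤ (1 / 2 : ℝ) then ((SAlpha.amplitudePhase 3 (227 / 40) (Poly.eval Q0) (Poly.eval (Poly.deriv Q0))) θ) else (SAlpha.amplitudePhase 3 (227 / 40) (Poly.eval Q1) (Poly.eval (Poly.deriv Q1))) θ) else (SAlpha.amplitudePhase 3 (227 / 40) (Poly.eval Q2) (Poly.eval (Poly.deriv Q2))) θ) else (SAlpha.amplitudePhase 3 (227 / 40) (Poly.eval Q3) (Poly.eval (Poly.deriv Q3))) θ) (Icc 0 (7 / 4 : ℝ)) := by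
    refine SAlpha.EnergyDominatesOn.glue (g2.mono ?_) (h3.mono ?_) ?_
    · intro θ hθ; exact ⟨hθ.1.1, hθ.2⟩
    · intro θ hθ; exact ⟨hθ.2, hθ.1.2⟩
    · simp only [show ¬ ((3 / 2 : ℝ) ≤ (1 / 2 : ℝ)) from by norm_num, show ¬ ((3 / 2 : ℝ) ≤ (1 : ℝ)) from by norm_num, if_false]
      exact ss35675_junction23
  have g4 : SAlpha.EnergyDominatesOn 3 (227 / 40) (fun θ => if θ ≤ (7 / 4 : ℝ) then (if θ ≤ (3 / 2 : ℝ) then (if θ ≤ (1 : ℝ) then (if θ ≤ (1 / 2 : ℝ) then ((SAlpha.amplitudePhase 3 (227 / 40) (Poly.eval Q0) (Poly.eval (Poly.deriv Q0))) θ) else (SAlpha.amplitudePhase 3 (227 / 40) (Poly.eval Q1) (Poly.eval (Poly.deriv Q1))) θ) else (SAlpha.amplitudePhase 3 (227 / 40) (Poly.eval Q2) (Poly.eval (Poly.deriv Q2))) θ) else (SAlpha.amplitudePhase 3 (227 / 40) (Poly.eval Q3) (Poly.eval (Poly.deriv Q3))) θ) else (SAlpha.amplitudePhase 3 (227 / 40)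 (Poly.eval Q4) (Poly.eval (Poly.deriv Q4))) θ) (Icc 0 (2 : ℝ)) := by
    refine SAlpha.EnergyDominatesOn.glue (g3.mono ?_) (h4.mono ?_) ?_
    · intro θ hθ; exact ⟨hθ.1.1, hθ.2⟩
    · intro θ hθ; exact ⟨hθ.2, hθ.1.2⟩
    · simp only [show ¬ ((7 / 4 : ℝ) ≤ (1 / 2 : ℝ)) from by norm_num, show ¬ ((7 / 4 : ℝ) ≤ (1 : ℝ)) from by norm_num, show ¬ ((7 / 4 : ℝ) ≤ (3 / 2 : ℝ)) from by norm_num, if_false]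
      exact ss35675_junction34
  have g5 : SAlpha.EnergyDominatesOn 3 (227 / 40) (fun θ => if θ ≤ (2 : ℝ) then (if θ ≤ (7 / 4 : ℝ) then (if θ ≤ (3 / 2 : ℝ) then (if θ ≤ (1 : ℝ) then (if θ ≤ (1 / 2 : ℝ) then ((SAlpha.amplitudePhase 3 (227 / 40) (Poly.eval Q0) (Poly.eval (Poly.deriv Q0))) θ) else (SAlpha.amplitudePhase 3 (227 / 40) (Poly.eval Q1) (Poly.eval (Poly.deriv Q1))) θ) else (SAlpha.amplitudePhase 3 (227 / 40) (Poly.eval Q2) (Poly.eval (Poly.deriv Q2))) θ) else (SAlpha.amplitudePhase 3 (227 / 40) (Poly.eval Q3) (Poly.eval (Poly.deriv Q3))) θ) else (SAlpha.amplitudePhase 3 (227 / 40) (Poly.eval Q4) (Poly.eval (Poly.deriv Q4))) θ) else (SAlpha.amplitudePhase 3 (227 / 40) (Poly.eval Q5) (Poly.eval (Poly.deriv Q5))) θ) (Icc 0 (5 / 2 : ℝ)) := by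
    refine SAlpha.EnergyDominatesOn.glue (g4.mono ?_) (h5.mono ?_) ?_
    · intro θ hθ; exact ⟨hθ.1.1, hθ.2⟩
    · intro θ hθ; exact ⟨hθ.2, hθ.1.2⟩
    · simp only [show ¬ ((2 : ℝ) ≤ (1 / 2 : ℝ)) from by norm_num, show ¬ ((2 : ℝ) ≤ (1 : ℝ)) from by norm_num, show ¬ ((2 : ℝ) ≤ (3 / 2 : ℝ)) from by norm_num, show ¬ ((2 : ℝ) ≤ (7 / 4 : ℝ)) from by norm_num, if_false]
      exact ss35675_junction45
  have g6 : SAlpha.EnergyDominatesOn 3 (227 / 40) (fun θ => if θ ≤ (5 / 2 : ℝ) then (if θ ≤ (2 : ℝ) then (if θ ≤ (7 / 4 : ℝ) then (if θ ≤ (3 / 2 : ℝ) then (if θ ≤ (1 : ℝ) then (if θ ≤ (1 / 2 : ℝ) then ((SAlpha.amplitudePhase 3 (227 / 40) (Poly.eval Q0) (Poly.eval (Poly.deriv Q0))) θ) else (SAlpha.amplitudePhase 3 (227 / 40) (Poly.eval Q1) (Poly.eval (Poly.deriv Q1))) θ) else (SAlpha.amplitudePhase 3 (227 / 40) (Poly.eval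 Q2) (Poly.eval (Poly.deriv Q2))) θ) else (SAlpha.amplitudePhase 3 (227 / 40) (Poly.eval Q3) (Poly.eval (Poly.deriv Q3))) θ) else (SAlpha.amplitudePhase 3 (227 / 40) (Poly.eval Q4) (Poly.eval (Poly.deriv Q4))) θ) else (SAlpha.amplitudePhase 3 (227 / 40) (Poly.eval Q5) (Poly.eval (Poly.deriv Q5))) θ) else (SAlpha.amplitudePhase 3 (227 / 40) (Poly.eval Q6) (Poly.eval (Poly.deriv Q6))) θ) (Icc 0 (3 : ℝ)) := by
    refine SAlpha.EnergyDominatesOn.glue (g5.mono ?_) (h6.mono ?_) ?_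
    · intro θ hθ; exact ⟨hθ.1.1, hθ.2⟩
    · intro θ hθ; exact ⟨hθ.2, hθ.1.2⟩
    · simp only [show ¬ ((5 / 2 : ℝ) ≤ (1 / 2 : ℝ)) from by norm_num, show ¬ ((5 / 2 : ℝ) ≤ (1 : ℝ)) from by norm_num, show ¬ ((5 / 2 : ℝ) ≤ (3 / 2 : ℝ)) from by norm_num, show ¬ ((5 / 2 : ℝ) ≤ (7 / 4 : ℝ)) from by norm_num, show ¬ ((5 / 2 : ℝ) ≤ (2 : ℝ)) from by norm_num, if_false]
      exact ss35675_junction56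
  have g7 : SAlpha.EnergyDominatesOn 3 (227 / 40) (fun θ => if θ ≤ (3 : ℝ) then (if θ ≤ (5 / 2 : ℝ) then (if θ ≤ (2 : ℝ) then (if θ ≤ (7 / 4 : ℝ) then (if θ ≤ (3 / 2 : ℝ) then (if θ ≤ (1 : ℝ) then (if θ ≤ (1 / 2 : ℝ) then ((SAlpha.amplitudePhase 3 (227 / 40) (Poly.eval Q0) (Poly.eval (Poly.deriv Q0))) θ) else (SAlpha.amplitudePhase 3 (227 / 40) (Poly.eval Q1) (Poly.eval (Poly.deriv Q1))) θ) else (SAlpha.amplitudePhase 3 (227 / 40) (Poly.eval Q2) (Poly.eval (Poly.deriv Q2))) θ) else (SAlpha.amplitudePhase 3 (227 / 40) (Poly.eval Q3) (Poly.eval (Poly.deriv Q3))) θ) else (SAlpha.amplitudePhase 3 (227 / 40) (Poly.eval Q4) (Poly.eval (Poly.deriv Q4))) θ) else (SAlpha.amplitudePhase 3 (227 / 40) (Poly.eval Q5) (Poly.eval (Poly.deriv Q5))) θ) else (SAlpha.amplitudePhase 3 (227 / 40) (Poly.eval Q6) (Poly.eval (Poly.deriv Q6))) θ) else (SAlpha.amplitudePhase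 3 (227 / 40) (Poly.eval Q7) (Poly.eval (Poly.deriv Q7))) θ) (Icc 0 (4 : ℝ)) := by
    refine SAlpha.EnergyDominatesOn.glue (g6.mono ?_) (h7.mono ?_) ?_
    · intro θ hθ; exact ⟨hθ.1.1, hθ.2⟩
    · intro θ hθ; exact ⟨hθ.2, hθ.1.2⟩
    · simp only [show ¬ ((3 : ℝ) ≤ (1 / 2 : ℝ)) from by norm_num, show ¬ ((3 : ℝ) ≤ (1 : ℝ)) from by norm_num, show ¬ ((3 : ℝ) ≤ (3 / 2 : ℝ)) from by norm_num, show ¬ ((3 : ℝ) ≤ (7 / 4 : ℝ)) from by norm_num, show ¬ ((3 : ℝ) ≤ (2 : ℝ)) from by norm_num, show ¬ ((3 : ℝ) ≤ (5 / 2 : ℝ)) from by norm_num, if_false]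
      exact ss35675_junction67
  have g8 : SAlpha.EnergyDominatesOn 3 (227 / 40) (fun θ => if θ ≤ (4 : ℝ) then (if θ ≤ (3 : ℝ) then (if θ ≤ (5 / 2 : ℝ) then (if θ ≤ (2 : ℝ) then (if θ ≤ (7 / 4 : ℝ) then (if θ ≤ (3 / 2 : ℝ) then (if θ ≤ (1 : ℝ) then (if θ ≤ (1 / 2 : ℝ) then ((SAlpha.amplitudePhase 3 (227 / 40) (Poly.eval Q0) (Poly.eval (Poly.deriv Q0))) θ) else (SAlpha.amplitudePhase 3 (227 / 40) (Poly.eval Q1) (Poly.eval (Poly.deriv Q1))) θ) else (SAlpha.amplitudePhase 3 (227 / 40) (Poly.eval Q2) (Poly.eval (Poly.deriv Q2))) θ) else (SAlpha.amplitudePhase 3 (227 / 40) (Poly.eval Q3) (Poly.eval (Poly.deriv Q3))) θ) else (SAlpha.amplitudePhase 3 (227 / 40) (Poly.eval Q4) (Poly.eval (Poly.deriv Q4))) θ) else (SAlpha.amplitudePhase 3 (227 / 40) (Poly.eval Q5) (Poly.eval (Poly.deriv Q5))) θ) else (SAlpha.amplitudePhase 3 (227 / 40) (Poly.eval Q6)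 (Poly.eval (Poly.deriv Q6))) θ) else (SAlpha.amplitudePhase 3 (227 / 40) (Poly.eval Q7) (Poly.eval (Poly.deriv Q7))) θ) else (SAlpha.amplitudePhase 3 (227 / 40) (Poly.eval Q8) (Poly.eval (Poly.deriv Q8))) θ) (Icc 0 (6 : ℝ)) := by
    refine SAlpha.EnergyDominatesOn.glue (g7.mono ?_) (h8.mono ?_) ?_
    · intro θ hθ; exact ⟨hθ.1.1, hθ.2⟩
    · intro θ hθ; exact ⟨hθ.2, hθ.1.2⟩
    · simp only [show ¬ ((4 : ℝ) ≤ (1 / 2 : ℝ)) from by norm_num, show ¬ ((4 : ℝ) ≤ (1 : ℝ)) from by norm_num, show ¬ ((4 : ℝ) ≤ (3 / 2 : ℝ)) from by norm_num, show ¬ ((4 : ℝ) ≤ (7 / 4 : ℝ)) from by norm_num, show ¬ ((4 : ℝ) ≤ (2 : ℝ)) from by norm_num, show ¬ ((4 : ℝ) ≤ (5 / 2 : ℝ)) from by norm_num, show ¬ ((4 : ℝ) ≤ (3 : ℝ)) from by norm_num, if_false]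
      exact ss35675_junction78
  have g9 : SAlpha.EnergyDominatesOn 3 (227 / 40) (fun θ => if θ ≤ (6 : ℝ) then (if θ ≤ (4 : ℝ) then (if θ ≤ (3 : ℝ) then (if θ ≤ (5 / 2 : ℝ) then (if θ ≤ (2 : ℝ) then (if θ ≤ (7 / 4 : ℝ) then (if θ ≤ (3 / 2 : ℝ) then (if θ ≤ (1 : ℝ) then (if θ ≤ (1 / 2 : ℝ) then ((SAlpha.amplitudePhase 3 (227 / 40) (Poly.eval Q0) (Poly.eval (Poly.deriv Q0))) θ) else (SAlpha.amplitudePhase 3 (227 / 40) (Poly.eval Q1) (Poly.eval (Poly.deriv Q1))) θ) else (SAlpha.amplitudePhase 3 (227 / 40) (Poly.eval Q2) (Poly.eval (Poly.deriv Q2))) θ) else (SAlpha.amplitudePhase 3 (227 / 40) (Poly.eval Q3) (Poly.eval (Poly.deriv Q3))) θ) else (SAlpha.amplitudePhase 3 (227 / 40) (Poly.eval Q4) (Poly.eval (Poly.deriv Q4))) θ) else (SAlpha.amplitudePhase 3 (227 / 40) (Poly.eval Q5) (Poly.eval (Poly.deriv Q5))) θ) else (SAlpha.amplitudePhase 3 (227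 / 40) (Poly.eval Q6) (Poly.eval (Poly.deriv Q6))) θ) else (SAlpha.amplitudePhase 3 (227 / 40) (Poly.eval Q7) (Poly.eval (Poly.deriv Q7))) θ) else (SAlpha.amplitudePhase 3 (227 / 40) (Poly.eval Q8) (Poly.eval (Poly.deriv Q8))) θ) else (SAlpha.amplitudePhase 3 (227 / 40) (Poly.eval Q9) (Poly.eval (Poly.deriv Q9))) θ) (Icc 0 (10 : ℝ)) := by
    refine SAlpha.EnergyDominatesOn.glue (g8.mono ?_) (h9.mono ?_) ?_
    · intro θ hθ; exact ⟨hθ.1.1, hθ.2⟩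
    · intro θ hθ; exact ⟨hθ.2, hθ.1.2⟩
    · simp only [show ¬ ((6 : ℝ) ≤ (1 / 2 : ℝ)) from by norm_num, show ¬ ((6 : ℝ) ≤ (1 : ℝ)) from by norm_num, show ¬ ((6 : ℝ) ≤ (3 / 2 : ℝ)) from by norm_num, show ¬ ((6 : ℝ) ≤ (7 / 4 : ℝ)) from by norm_num, show ¬ ((6 : ℝ) ≤ (2 : ℝ)) from by norm_num, show ¬ ((6 : ℝ) ≤ (5 / 2 : ℝ)) from by norm_num, show ¬ ((6 : ℝ) ≤ (3 : ℝ)) from by norm_num, show ¬ ((6 : ℝ) ≤ (4 : ℝ)) from by norm_num, if_false]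
      exact ss35675_junction89
  have g10 : SAlpha.EnergyDominatesOn 3 (227 / 40) (fun θ => if θ ≤ (10 : ℝ) then (if θ ≤ (6 : ℝ) then (if θ ≤ (4 : ℝ) then (if θ ≤ (3 : ℝ) then (if θ ≤ (5 / 2 : ℝ) then (if θ ≤ (2 : ℝ) then (if θ ≤ (7 / 4 : ℝ) then (if θ ≤ (3 / 2 : ℝ) then (if θ ≤ (1 : ℝ) then (if θ ≤ (1 / 2 : ℝ) then ((SAlpha.amplitudePhase 3 (227 / 40) (Poly.eval Q0) (Poly.eval (Poly.deriv Q0))) θ) else (SAlpha.amplitudePhase 3 (227 / 40) (Poly.eval Q1) (Poly.eval (Poly.deriv Q1))) θ) else (SAlpha.amplitudePhase 3 (227 / 40) (Poly.eval Q2) (Poly.eval (Poly.deriv Q2))) θ) else (SAlpha.amplitudePhase 3 (227 / 40) (Poly.eval Q3) (Poly.eval (Poly.deriv Q3))) θ) else (SAlpha.amplitudePhase 3 (227 / 40) (Poly.eval Q4) (Poly.eval (Poly.deriv Q4))) θ) else (SAlpha.amplitudePhase 3 (227 / 40) (Poly.eval Q5) (Poly.eval (Poly.deriv Q5))) θ)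 else (SAlpha.amplitudePhase 3 (227 / 40) (Poly.eval Q6) (Poly.eval (Poly.deriv Q6))) θ) else (SAlpha.amplitudePhase 3 (227 / 40) (Poly.eval Q7) (Poly.eval (Poly.deriv Q7))) θ) else (SAlpha.amplitudePhase 3 (227 / 40) (Poly.eval Q8) (Poly.eval (Poly.deriv Q8))) θ) else (SAlpha.amplitudePhase 3 (227 / 40) (Poly.eval Q9) (Poly.eval (Poly.deriv Q9))) θ) else (SAlpha.amplitudePhase 3 (227 / 40) (Poly.eval Q10) (Poly.eval (Poly.deriv Q10))) θ) (Icc 0 (14 : ℝ)) := by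
    refine SAlpha.EnergyDominatesOn.glue (g9.mono ?_) (h10.mono ?_) ?_
    · intro θ hθ; exact ⟨hθ.1.1, hθ.2⟩
    · intro θ hθ; exact ⟨hθ.2, hθ.1.2⟩
    · simp only [show ¬ ((10 : ℝ) ≤ (1 / 2 : ℝ)) from by norm_num, show ¬ ((10 : ℝ) ≤ (1 : ℝ)) from by norm_num, show ¬ ((10 : ℝ) ≤ (3 / 2 : ℝ)) from by norm_num, show ¬ ((10 : ℝ) ≤ (7 / 4 : ℝ)) from by norm_num, show ¬ ((10 : ℝ) ≤ (2 : ℝ)) from by norm_num, show ¬ ((10 : ℝ) ≤ (5 / 2 : ℝ)) from by norm_num, show ¬ ((10 : ℝ) ≤ (3 : ℝ)) from by norm_num, show ¬ ((10 : ℝ) ≤ (4 : ℝ)) from by norm_num, show ¬ ((10 : ℝ) ≤ (6 : ℝ)) from by norm_num, if_false]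
      exact ss35675_junction910
  refine SAlpha.EnergyDominatesOn.glue (g10.mono ?_) (h11.mono ?_) ?_
  · intro θ hθ; exact ⟨hθ.1.1, hθ.2⟩
  · intro θ hθ; exact ⟨hθ.2, hθ.1.2⟩
  · simp only [show ¬ ((14 : ℝ) ≤ (1 / 2 : ℝ)) from by norm_num, show ¬ ((14 : ℝ) ≤ (1 : ℝ)) from by norm_num, show ¬ ((14 : ℝ) ≤ (3 / 2 : ℝ)) from by norm_num, show ¬ ((14 : ℝ) ≤ (7 / 4 : ℝ)) from by norm_num, show ¬ ((14 : ℝ) ≤ (2 : ℝ)) from by norm_num, show ¬ ((14 : ℝ) ≤ (5 / 2 : ℝ)) from by norm_num, show ¬ ((14 : ℝ) ≤ (3 : ℝ)) from by norm_num, show ¬ ((14 : ℝ) ≤ (4 : ℝ)) from by norm_num, show ¬ ((14 : ℝ) ≤ (6 : ℝ)) from by norm_num, show ¬ ((14 : ℝ) ≤ (10 : ℝ)) from by norm_num, if_false]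
    exact ss35675_junction1011

/-- **THE ROW: `(s, α) = (3, 227/40)` IS ON THE STABLE SIDE OF THE `s–α` MODEL** — no window carries an `SAlpha.UnstableWitness`
(glued polynomial core on `[−18, 18]` by reflection, lit-4's explicit tail amplitude `(1 − c/θ)(1 + α cos θ/θ²)`, `c = 8`, beyond).
MODEL `s–α`; «stable» in the model's own one-surface (Newcomb) sense; nothing about a device. [instance data] -/
theorem stableSide_three_5675 : SAlpha.StableSide 3 (227 / 40) := by
  have hcore := ss35675_dominates_core
  have htail := SAlpha.energyDominatesOn_tail (s := 3) (α := 227 / 40) (c := 8) (T := 18)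
    (by norm_num) (by norm_num) (by norm_num) (by norm_num) (by norm_num) ss35675_tailBound_nonneg
  refine SAlpha.stableSide_of_core_tail (by norm_num) hcore ?_ htail ?_
  · simp only [show ((0:ℝ) ≤ (1 / 2 : ℝ)) from by norm_num, show ((0:ℝ) ≤ (1 : ℝ)) from by norm_num, show ((0:ℝ) ≤ (3 / 2 : ℝ)) from by norm_num, show ((0:ℝ) ≤ (7 / 4 : ℝ)) from by norm_num, show ((0:ℝ) ≤ (2 : ℝ)) from by norm_num, show ((0:ℝ) ≤ (5 / 2 : ℝ)) from by norm_num, show ((0:ℝ) ≤ (3 : ℝ)) from by norm_num, show ((0:ℝ) ≤ (4 : ℝ)) from by norm_num, show ((0:ℝ) ≤ (6 : ℝ)) from by norm_num, show ((0:ℝ) ≤ (10 : ℝ)) from by norm_num, show ((0:ℝ) ≤ (14 : ℝ)) from by norm_num, if_true]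
    exact (SAlpha.amplitudePhase_zero_of_deriv_zero Q0d_at_zero.symm).le
  · have ht0 : ¬ ((18 : ℝ) ≤ (1 / 2 : ℝ)) := by norm_num
    have ht1 : ¬ ((18 : ℝ) ≤ (1 : ℝ)) := by norm_num
    have ht2 : ¬ ((18 : ℝ) ≤ (3 / 2 : ℝ)) := by norm_num
    have ht3 : ¬ ((18 : ℝ) ≤ (7 / 4 : ℝ)) := by norm_num
    have ht4 : ¬ ((18 : ℝ) ≤ (2 : ℝ)) := by norm_num
    have ht5 : ¬ ((18 : ℝ) ≤ (5 / 2 : ℝ)) := by norm_num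
    have ht6 : ¬ ((18 : ℝ) ≤ (3 : ℝ)) := by norm_num
    have ht7 : ¬ ((18 : ℝ) ≤ (4 : ℝ)) := by norm_num
    have ht8 : ¬ ((18 : ℝ) ≤ (6 : ℝ)) := by norm_num
    have ht9 : ¬ ((18 : ℝ) ≤ (10 : ℝ)) := by norm_num
    have ht10 : ¬ ((18 : ℝ) ≤ (14 : ℝ)) := by norm_num
    simp only [ht0, ht1, ht2, ht3, ht4, ht5, ht6, ht7, ht8, ht9, ht10, if_false]
    rw [SAlpha.amplitudePhase_le_iff]
    exact (SAlpha.tail_logDeriv_le (s := 3) (α := 227 / 40) (c := 8) (T := 18)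
      (by norm_num) (by norm_num) (by norm_num) (by norm_num) (by norm_num)).trans ss35675_junction_tail

/-- Corollary in lit-3's words: at `(s, α) = (3, 227/40)` there is no `SAlpha.UnstableWitness` on ANY window. [instance data] -/
theorem not_unstableWitness_three_5675 (a b : ℝ) (X X' : ℝ → ℝ) :
    ¬ SAlpha.UnstableWitness 3 (227 / 40) a b X X' :=
  stableSide_three_5675 a b X X'

end SAlphaSecondStableS3A5675

end Summit.Ventures.FusionMHD.Models
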